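import Summits.QuantumFields.YangMills.Theorems.BalabanUVNodesN17ShiftModulusAnchor
import Summits.QuantumFields.YangMills.Theorems.BalabanUVNodesSpineRates
import Literature.MathematicalPhysics.QuantumFieldTheory.Balaban1983to89.Node00.Record13SepCoPH

/-!
# NODE N17 (NE4) — WHAT IT DELIVERS TO CRUX K2⁷'s LINE 2, PART 2: AT NODE 00's STAGE-13 RECORD `datumOfRecord₁₃SepCoPH`, and the K2⁷ v3 TEXTS SPELLED LITERALLY

Cell `pub-ymgap`, YM-PLAN Track A (HUMAN RULING D-0062 ∕ D-0149), WIDTH SEAT `pub-ymgap-dag-n17-w2` (gen 2), key K3⁷ stmt-QuantumFields-20544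
(`--kind proof --supports 20544 --as helper`, COUNT-NEUTRAL); via node N17 also K2⁷ stmt-QuantumFields-20543 LINE 2 (registered skeleton v3 `HOME/pub-ymgap-plan/D80-K2V3/K2Skeleton13SepCoPHv3.lean`
bdd723a03d543770: `stub_n17AtRecord13 : N17AtRecord13`, `stub_anchor13 : D4AnchorRecord13`, junction `d4ShiftRate13_of_n17_anchor`).  PART 1 = `…N17ShiftModulusAnchor.lean` (the generic
junction with constant `2c` and the lever under a summable modulus); this file instantiates it.

WHAT THIS FILE PROVES (theorems only; 0 `def`, 0 `instance`, 0 `sorry`).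
§1 ON ANY FINITE-ε DATUM `D : Datum F N` (re-key-proof: keyed on NO record edition), EVERY one-loop split `S` of `D.βfun`; `N17At D u` IS
`ScaleShiftRate (u.cr·u.C₅·u.θ) u.ρ u.γ D.βfun` (`YMDAG.UVSplit.N17At`, `Spine.NE4.Targets.NE4OnData`, `rfl`):
★ `remainderShiftRate_of_n17At_anchor` (`N17At D u`, `0 < u.γ` + anchor ⟹ `RemainderShiftRate S (2·(u.cr·u.C₅·u.θ)) u.ρ u.γ`, NO hypothesis on `u.ρ`); `const_nonneg_of_n17At`;
★★ `everySlope_of_n17At_anchor` (+ `0 ≤ u.ρ < 1` ⟹ `EverySlope S u.γ` — what line 2's `endpointExistence_of_residue_shiftRate_anchor` consumes, in ONE step from node N17);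
`af0r_of_n17At_anchor` ((AF-0r) for `S.β0`); `everySlope_of_summable_shiftModulus_anchor_datum` (the located minimum: a SUMMABLE modulus of `D.βfun` suffices).
§2 `N = 2`, THE K2⁷ v3 TEXTS SPELLED LITERALLY (the skeleton is not a tree module): `d4ShiftRate13_two_mul_of_n17_anchor` = the bodies of
`N17AtRecord13 → D4AnchorRecord13 → D4ShiftRateRecord13` with `c₁ := 2c`, `ϑ := u.ρ`, `γ₁ := θ.γ` (a DROP-IN for the skeleton's `d4ShiftRate13_of_n17_anchor`; `0 < θ.γ` from
admissibility); `everySlope13_of_n17_anchor` (N17 + S2 ⟹ every-slope of the record's definitional split on `]0, θ.γ]` — the input of `D1Residue.endpointExistence_of_residue` on line 2,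
reached WITHOUT the S1 detour); `af0r13_of_n17_anchor` (N17 + S2 ⟹ (AF-0r) for the record's one-loop numbers `Node00.beta0OfMerged … θ.v₀` — NODE O row G-an2-4's CONCLUSION at the
record, CRIT-2's «bonus», as a tree theorem).
§3 (EDITION 2, append-only) THE SUMMABLE-SHIFT HEDGE of line 2: `everySlope13_of_summableShift_anchor` — «∃ summable two-run modulus of the record's β on the
θ.γ-boxes» (strictly WEAKER than `N17AtRecord13`, Part 1 §4) + S2 ⟹ every-slope of the definitional split, ∀-form — line 2's END composition goes through verbatim with it in
place of S1 + lever; `summableShift13_of_n17` — the N17 body implies the summable hypothesis (the hedge is a weakening).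

HONEST SCOPE (A6, director-ym №189).  §1 quantifies over an ARBITRARY datum; §2 over `θ : Stage13HParams F 2` with `hP : θ.Provisos₁₃SepCoPH F 2` — inhabited iff K0⁷
(stmt-QuantumFields-20541) — and over the N17 ∕ anchor ∕ modulus HYPOTHESES, all LOCATED (NE4: GAPS G-t4-U2-1, [Balaban1987RG1] p. 264; anchor: (2.13) p. 268 per scale, with CRIT-2's price P2 «joint corner limit =
`beta0OfMerged` path limit» untouched), none discharged.  NOT a proof of `stub_n17AtRecord13`, `stub_anchor13` or any K2⁷∕K3⁷ stub; N17 NOT discharged; K2⁷ ∕ K3⁷ OPEN; counts UNMOVED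
(typed 28∕28 · discharged 5∕27 · A 5∕28).  One finite four-torus programme at fixed `ε = L^{−K}`, Bałaban AS PRINTED; the YM mass gap (Clay) is NOT proved by any of this — R4 closes
the conditional finite-𝕋⁴ rung `BalabanLadder.UV` only; nothing continuum ∕ ℝ⁴ ∕ OS.  No `instance`, no `notation`, no `axiom`.
References: [I] = [Balaban1987RG1] T. Bałaban, Commun. Math. Phys. **109** (1987): (1.20)–(1.22) p. 264, (2.12)–(2.14) p. 268, Thm 3 p. 264.
-/

noncomputable section

open scoped Matrix.Norms.L2Operator

namespace Summit.QuantumFields.YangMills.BalabanUVNodes.N17ShiftModulusAnchorRecord13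

open Literature.MathematicalPhysics.QuantumFieldTheory.Balaban1983to89
open Literature.MathematicalPhysics.QuantumFieldTheory.Balaban1983to89.FlowStep
open Literature.MathematicalPhysics.QuantumFieldTheory.Balaban1983to89.T4CouplingMatching (ScaleShiftRate RemainderShiftRate)
open Summit.QuantumFields.BalabanUV.Gaps.CapSignsConstRoad (EverySlope)
open Summit.QuantumFields.YangMills.BalabanUVNodes.N17ShiftModulusAnchor
open Filter Topology

/-! ## §1 On ANY finite-ε datum `D` (re-key-proof): what node N17 `N17At D u` + the per-scale anchor deliver, for EVERY one-loop split of `D.βfun` -/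

section OnDatum

open YMDAG.UVSplit (Datum U3Carriers N17At)
open Literature.MathematicalPhysics.QuantumFieldTheory.Balaban1983to89.T4Continuum (T4Family)

variable {F : T4Family} {N : ℕ} [NeZero N]

/-- ★ **N17 ON THE DATUM + THE PER-SCALE ANCHOR ⟹ THE REMAINDER's SCALE-SHIFT RATE on node U3's window, constant `2·(u.cr·u.C₅·u.θ)`, rate letter `u.ρ` UNCONSTRAINED** —
for EVERY one-loop split `S` of the datum's β-family (at NODE 00's records: the definitional `Node00.oneLoopSplit_betaOfMerged …` of K2⁷'s texts, §2).  `N17At D u` IS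
`ScaleShiftRate (u.cr·u.C₅·u.θ) u.ρ u.γ D.βfun` (`YMDAG.UVSplit.N17At`, `Spine.NE4.Targets.NE4OnData`, by `rfl`); keyed on NO record edition, so every re-key (`…Sep`, `…CoPH`, …)
instantiates it verbatim. [cite: Balaban1987RG1, (2.12)-(2.14) p.268 and (1.22) p.264] -/
theorem remainderShiftRate_of_n17At_anchor (D : Datum F N) (S : B12Beta.OneLoopSplit D.βfun)
    (hA : ∀ (k : ℕ) (δ : ℝ), 0 < δ → ∃ γ' : ℝ, 0 < γ' ∧ ∀ v ∈ Box γ' k, |S.β1 k v| ≤ δ)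
    {u : U3Carriers} (hγ : 0 < u.γ) (h17 : N17At D u) :
    RemainderShiftRate S (2 * (u.cr * u.C₅ * u.θ)) u.ρ u.γ := by
  have h' : ScaleShiftRate (u.cr * u.C₅ * u.θ) u.ρ u.γ D.βfun := h17
  exact remainderShiftRate_two_mul_of_scaleShiftRate_anchor S hγ hA h'

/-- The constant of node N17 on a datum with a non-empty window is non-negative (`shiftModulus_nonneg` at scale `0`). [folklore] -/
theorem const_nonneg_of_n17At (D : Datum F N) {u : U3Carriers} (hγ : 0 < u.γ) (h17 : N17At D u) : 0 ≤ u.cr * u.C₅ * u.θ := by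
  have h' : ScaleShiftRate (u.cr * u.C₅ * u.θ) u.ρ u.γ D.βfun := h17
  simpa using shiftModulus_nonneg (β := D.βfun) (a := fun k => u.cr * u.C₅ * u.θ * u.ρ ^ k) hγ h' 0

/-- ★★ **N17 ON THE DATUM WITH `0 ≤ u.ρ < 1` (K2⁷'s displayed junction letters) + THE PER-SCALE ANCHOR ⟹ EVERY-SLOPE of any one-loop split of `D.βfun` on node U3's window
`]0, u.γ]`** — what K2⁷ line 2's `endpointExistence_of_residue_shiftRate_anchor` consumes, in ONE step from node N17. [cite: Balaban1987RG1, (2.12)-(2.14) p.268 and Thm 3 p.264] -/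
theorem everySlope_of_n17At_anchor (D : Datum F N) (S : B12Beta.OneLoopSplit D.βfun)
    (hA : ∀ (k : ℕ) (δ : ℝ), 0 < δ → ∃ γ' : ℝ, 0 < γ' ∧ ∀ v ∈ Box γ' k, |S.β1 k v| ≤ δ)
    {u : U3Carriers} (hγ : 0 < u.γ) (hρ0 : 0 ≤ u.ρ) (hρ1 : u.ρ < 1) (h17 : N17At D u) : EverySlope S u.γ := by
  have h' : ScaleShiftRate (u.cr * u.C₅ * u.θ) u.ρ u.γ D.βfun := h17
  exact everySlope_of_scaleShiftRate_anchor S hγ hρ0 hρ1 hA h'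

/-- **N17 ON THE DATUM (`u.ρ < 1`) + THE PER-SCALE ANCHOR ⟹ (AF-0r) FOR THE SPLIT's ONE-LOOP NUMBERS**: a limit `β⁰_∞` with `|β⁰_{k+1} − β⁰_∞| ≤ (c∕(1−u.ρ))·u.ρ^k`,
`c = u.cr·u.C₅·u.θ` (NODE O row G-an2-4's conclusion for this split, re-derived from node N17's slot). [folklore] -/
theorem af0r_of_n17At_anchor (D : Datum F N) (S : B12Beta.OneLoopSplit D.βfun)
    (hA : ∀ (k : ℕ) (δ : ℝ), 0 < δ → ∃ γ' : ℝ, 0 < γ' ∧ ∀ v ∈ Box γ' k, |S.β1 k v| ≤ δ)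
    {u : U3Carriers} (hγ : 0 < u.γ) (hρ1 : u.ρ < 1) (h17 : N17At D u) :
    ∃ binf : ℝ, ∀ k, |S.β0 k - binf| ≤ (u.cr * u.C₅ * u.θ) / (1 - u.ρ) * u.ρ ^ k := by
  have h' : ScaleShiftRate (u.cr * u.C₅ * u.θ) u.ρ u.γ D.βfun := h17
  exact conv_of_scaleShiftRate_anchor S hγ hρ1 hA h'

/-- **THE WEAKER INPUT SUFFICES ON ANY DATUM**: a SUMMABLE scale-shift modulus of `D.βfun` on the `]0,γ]`-boxes + the per-scale anchor ⟹ every-slope on `]0,γ]` — the located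
minimum K2⁷ line 2 needs from node N17's slot (NE4 gives the geometric, a fortiori summable, modulus).  (= Part 1's `everySlope_of_summable_shiftModulus_anchor` at `β := D.βfun`;
displayed for the consumers' convenience.) [cite: Balaban1987RG1, (2.12)-(2.14) p.268 and Thm 3 p.264] -/
theorem everySlope_of_summable_shiftModulus_anchor_datum (D : Datum F N) (S : B12Beta.OneLoopSplit D.βfun)
    (hA : ∀ (k : ℕ) (δ : ℝ), 0 < δ → ∃ γ' : ℝ, 0 < γ' ∧ ∀ v ∈ Box γ' k, |S.β1 k v| ≤ δ)
    {γ : ℝ} (hγ : 0 < γ) {a : ℕ → ℝ} (ha : Summable a)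
    (h : ∀ k (w : Fin (k + 2) → ℝ), w ∈ Box γ (k + 1) → |D.βfun (k + 1) w - D.βfun k (Fin.tail w)| ≤ a k) :
    EverySlope S γ :=
  everySlope_of_summable_shiftModulus_anchor S hγ hA h ha

end OnDatum

/-! ## §2 `N = 2`: the K2⁷ v3 texts `N17AtRecord13`, `D4AnchorRecord13`, `D4ShiftRateRecord13` spelled literally (the skeleton is not a tree module) -/

section K2Texts

open Literature.MathematicalPhysics.QuantumFieldTheory.Balaban1983to89.T4Continuum (T4Family)
open Literature.MathematicalPhysics.QuantumFieldTheory.Balaban1983to89.Node00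
open YMDAG.UVSplit (U3Carriers N17At)

/-- **THE K2⁷ LINE-2 JUNCTION AT THE RECORD WITH CONSTANT `2c` (drop-in for the skeleton's `d4ShiftRate13_of_n17_anchor`)**: the bodies of
`N17AtRecord13 → D4AnchorRecord13 → D4ShiftRateRecord13` (K2⁷ v3 bdd723a03d543770 §L2.3, verbatim), witnesses `c₁ := 2·(u.cr·u.C₅·u.θ)` (`≥ 0` by
`shiftModulus_nonneg` at scale `0`), `ϑ := u.ρ`, `γ₁ := θ.γ` (`0 < θ.γ` from admissibility, `Stage9Params.Admissible.gamma_pos`).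
[cite: Balaban1987RG1, (2.12)-(2.14) p.268 and (1.22) p.264] -/
theorem d4ShiftRate13_two_mul_of_n17_anchor
    (hN : ∀ (F : T4Family) (θ : Stage13HParams F 2) (hP : θ.Provisos₁₃SepCoPH F 2), θ.Admissible F 2 →
      ∃ u : U3Carriers, u.γ = θ.γ ∧ 0 ≤ u.ρ ∧ u.ρ < 1 ∧ N17At (datumOfRecord₁₃SepCoPH F 2 θ hP) u)
    (hA : ∀ (F : T4Family) (θ : Stage13HParams F 2) (hP : θ.Provisos₁₃SepCoPH F 2), θ.Admissible F 2 →
      letI := θ.instVβ₁; letI := θ.instVβ₂; letI := θ.instιβ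
      ∀ (k : ℕ) (δ : ℝ), 0 < δ → ∃ γ' : ℝ, 0 < γ' ∧ ∀ v ∈ Box γ' k,
        |(oneLoopSplit_betaOfMerged (betaMerged F (mergedTermFamilyMatT F 2 (TcanOfRecord F 2) (chiFixed29 F 2 θ.ν θ.ε₂₉) θ.εbg) θ.ρ8 θ.bV)
            (beta0OfMerged (betaMerged F (mergedTermFamilyMatT F 2 (TcanOfRecord F 2) (chiFixed29 F 2 θ.ν θ.ε₂₉) θ.εbg) θ.ρ8 θ.bV) θ.v₀) θ.γ).β1 k v| ≤ δ) :
    ∀ (F : T4Family) (θ : Stage13HParams F 2) (hP : θ.Provisos₁₃SepCoPH F 2), θ.Admissible F 2 →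
      letI := θ.instVβ₁; letI := θ.instVβ₂; letI := θ.instιβ
      ∃ c₁ ϑ γ₁ : ℝ, 0 ≤ c₁ ∧ 0 ≤ ϑ ∧ ϑ < 1 ∧ 0 < γ₁ ∧ γ₁ ≤ θ.γ ∧
        RemainderShiftRate
          (oneLoopSplit_betaOfMerged (betaMerged F (mergedTermFamilyMatT F 2 (TcanOfRecord F 2) (chiFixed29 F 2 θ.ν θ.ε₂₉) θ.εbg) θ.ρ8 θ.bV)
            (beta0OfMerged (betaMerged F (mergedTermFamilyMatT F 2 (TcanOfRecord F 2) (chiFixed29 F 2 θ.ν θ.ε₂₉) θ.εbg) θ.ρ8 θ.bV) θ.v₀) θ.γ)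
          c₁ ϑ γ₁ := by
  intro F θ hP hθ
  letI := θ.instVβ₁; letI := θ.instVβ₂; letI := θ.instιβ
  obtain ⟨u, hγu, hρ0, hρ1, h17⟩ := hN F θ hP hθ
  have hγθ : 0 < θ.γ := hθ.toStage12.toStage9.gamma_pos
  have hγ : 0 < u.γ := by rw [hγu]; exact hγθ
  have hrem := remainderShiftRate_of_n17At_anchor (datumOfRecord₁₃SepCoPH F 2 θ hP) _ (hA F θ hP hθ) hγ h17
  rw [hγu] at hrem
  exact ⟨2 * (u.cr * u.C₅ * u.θ), u.ρ, θ.γ, mul_nonneg zero_le_two (const_nonneg_of_n17At _ hγ h17), hρ0, hρ1, hγθ, le_rfl, hrem⟩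

/-- **N17 + S2 ⟹ EVERY-SLOPE OF THE RECORD's DEFINITIONAL SPLIT ON `]0, θ.γ]`, ∀-form over the admissible Stage-13 tuples of `SU(2)` data** — the input of
`D1Residue.endpointExistence_of_residue` on K2⁷ line 2 (the skeleton reaches it through `D4ShiftRateRecord13`; here in one step). [cite: Balaban1987RG1, (2.12)-(2.14) p.268 and Thm 3 p.264] -/
theorem everySlope13_of_n17_anchor
    (hN : ∀ (F : T4Family) (θ : Stage13HParams F 2) (hP : θ.Provisos₁₃SepCoPH F 2), θ.Admissible F 2 →
      ∃ u : U3Carriers, u.γ = θ.γ ∧ 0 ≤ u.ρ ∧ u.ρ < 1 ∧ N17At (datumOfRecord₁₃SepCoPH F 2 θ hP) u)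
    (hA : ∀ (F : T4Family) (θ : Stage13HParams F 2) (hP : θ.Provisos₁₃SepCoPH F 2), θ.Admissible F 2 →
      letI := θ.instVβ₁; letI := θ.instVβ₂; letI := θ.instιβ
      ∀ (k : ℕ) (δ : ℝ), 0 < δ → ∃ γ' : ℝ, 0 < γ' ∧ ∀ v ∈ Box γ' k,
        |(oneLoopSplit_betaOfMerged (betaMerged F (mergedTermFamilyMatT F 2 (TcanOfRecord F 2) (chiFixed29 F 2 θ.ν θ.ε₂₉) θ.εbg) θ.ρ8 θ.bV)
            (beta0OfMerged (betaMerged F (mergedTermFamilyMatT F 2 (TcanOfRecord F 2) (chiFixed29 F 2 θ.ν θ.ε₂₉) θ.εbg) θ.ρ8 θ.bV) θ.v₀) θ.γ).β1 k v| ≤ δ)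
    (F : T4Family) (θ : Stage13HParams F 2) (hP : θ.Provisos₁₃SepCoPH F 2) (hθ : θ.Admissible F 2) :
    letI := θ.instVβ₁; letI := θ.instVβ₂; letI := θ.instιβ
    EverySlope
      (oneLoopSplit_betaOfMerged (betaMerged F (mergedTermFamilyMatT F 2 (TcanOfRecord F 2) (chiFixed29 F 2 θ.ν θ.ε₂₉) θ.εbg) θ.ρ8 θ.bV)
        (beta0OfMerged (betaMerged F (mergedTermFamilyMatT F 2 (TcanOfRecord F 2) (chiFixed29 F 2 θ.ν θ.ε₂₉) θ.εbg) θ.ρ8 θ.bV) θ.v₀) θ.γ)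
      θ.γ := by
  letI := θ.instVβ₁; letI := θ.instVβ₂; letI := θ.instιβ
  obtain ⟨u, hγu, hρ0, hρ1, h17⟩ := hN F θ hP hθ
  have hγ : 0 < u.γ := by rw [hγu]; exact hθ.toStage12.toStage9.gamma_pos
  have hES := everySlope_of_n17At_anchor (datumOfRecord₁₃SepCoPH F 2 θ hP) _ (hA F θ hP hθ) hγ hρ0 hρ1 h17
  rwa [hγu] at hES

end K2Texts

section K2TextsAF0r

open Literature.MathematicalPhysics.QuantumFieldTheory.Balaban1983to89.T4Continuum (T4Family)
open Literature.MathematicalPhysics.QuantumFieldTheory.Balaban1983to89.Node00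
open YMDAG.UVSplit (U3Carriers N17At)

/-- **N17 + S2 ⟹ (AF-0r) FOR THE RECORD's ONE-LOOP NUMBERS `Node00.beta0OfMerged … θ.v₀`** (NODE O row G-an2-4's CONCLUSION at the Stage-13 record, `SU(2)`, ∀-form):
a limit `β⁰_∞` with `|β⁰_{k+1} − β⁰_∞| ≤ (c∕(1−ρ))·ρ^k`, `c = u.cr·u.C₅·u.θ`, `ρ = u.ρ` the junction letters of the tuple's N17 witness (the definitional split's `β0` field IS
`beta0OfMerged …`, `Node00.oneLoopSplit_betaOfMerged_β0`, `rfl`).  CRIT-2's «bonus» made a tree theorem. [cite: Balaban1987RG1, (2.12)-(2.14) p.268 and (1.22) p.264] -/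
theorem af0r13_of_n17_anchor
    (hN : ∀ (F : T4Family) (θ : Stage13HParams F 2) (hP : θ.Provisos₁₃SepCoPH F 2), θ.Admissible F 2 →
      ∃ u : U3Carriers, u.γ = θ.γ ∧ 0 ≤ u.ρ ∧ u.ρ < 1 ∧ N17At (datumOfRecord₁₃SepCoPH F 2 θ hP) u)
    (hA : ∀ (F : T4Family) (θ : Stage13HParams F 2) (hP : θ.Provisos₁₃SepCoPH F 2), θ.Admissible F 2 →
      letI := θ.instVβ₁; letI := θ.instVβ₂; letI := θ.instιβ
      ∀ (k : ℕ) (δ : ℝ), 0 < δ → ∃ γ' : ℝ, 0 < γ' ∧ ∀ v ∈ Box γ' k,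
        |(oneLoopSplit_betaOfMerged (betaMerged F (mergedTermFamilyMatT F 2 (TcanOfRecord F 2) (chiFixed29 F 2 θ.ν θ.ε₂₉) θ.εbg) θ.ρ8 θ.bV)
            (beta0OfMerged (betaMerged F (mergedTermFamilyMatT F 2 (TcanOfRecord F 2) (chiFixed29 F 2 θ.ν θ.ε₂₉) θ.εbg) θ.ρ8 θ.bV) θ.v₀) θ.γ).β1 k v| ≤ δ)
    (F : T4Family) (θ : Stage13HParams F 2) (hP : θ.Provisos₁₃SepCoPH F 2) (hθ : θ.Admissible F 2) :
    letI := θ.instVβ₁; letI := θ.instVβ₂; letI := θ.instιβ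
    ∃ (c ρ binf : ℝ), 0 ≤ c ∧ 0 ≤ ρ ∧ ρ < 1 ∧ ∀ k,
      |beta0OfMerged (betaMerged F (mergedTermFamilyMatT F 2 (TcanOfRecord F 2) (chiFixed29 F 2 θ.ν θ.ε₂₉) θ.εbg) θ.ρ8 θ.bV) θ.v₀ k - binf| ≤ c / (1 - ρ) * ρ ^ k := by
  letI := θ.instVβ₁; letI := θ.instVβ₂; letI := θ.instιβ
  obtain ⟨u, hγu, hρ0, hρ1, h17⟩ := hN F θ hP hθ
  have hγ : 0 < u.γ := by rw [hγu]; exact hθ.toStage12.toStage9.gamma_pos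
  have hc : 0 ≤ u.cr * u.C₅ * u.θ := const_nonneg_of_n17At _ hγ h17
  obtain ⟨binf, hconv⟩ := af0r_of_n17At_anchor (datumOfRecord₁₃SepCoPH F 2 θ hP) _ (hA F θ hP hθ) hγ hρ1 h17
  exact ⟨u.cr * u.C₅ * u.θ, u.ρ, binf, hc, hρ0, hρ1, hconv⟩

end K2TextsAF0r

/-! ## §3 (edition 2) `N = 2`: the SUMMABLE-SHIFT hedge of K2⁷ line 2 — every-slope of the record's definitional split from a summable scale-shift modulus + S2 -/

section K2TextsSummable

open Literature.MathematicalPhysics.QuantumFieldTheory.Balaban1983to89.T4Continuum (T4Family)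
open Literature.MathematicalPhysics.QuantumFieldTheory.Balaban1983to89.Node00

/-- **THE SUMMABLE-SHIFT HEDGE OF LINE 2 (∀-form over the admissible Stage-13 tuples of `SU(2)` data)**: IF at every admissible tuple the record's β-family has SOME summable
two-run scale-shift modulus on the `]0,θ.γ]`-boxes (a hypothesis SHAPE strictly WEAKER than `N17AtRecord13` — Part 1's `summable_shiftModulus_anchor_not_geometric`), THEN with
S2 (`D4AnchorRecord13`'s body) the record's definitional split is every-slope on `]0, θ.γ]` — exactly the input `EndpointGivenBR13SepCoPH_of_shiftCauchy` feeds (via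
`everySlope_of_shiftRate_anchor`) to `D1Residue.endpointExistence_of_residue`; so line 2's END composition goes through VERBATIM with this theorem in place of S1 + the lever, i.e.
K2⁷'s every-slope road does not need NE4's GEOMETRIC rate.  A located statement-robustness fact for the planner; no stub text is changed here. [cite: Balaban1987RG1, (2.12)-(2.14) p.268 and Thm 3 p.264] -/
theorem everySlope13_of_summableShift_anchor
    (hS : ∀ (F : T4Family) (θ : Stage13HParams F 2) (hP : θ.Provisos₁₃SepCoPH F 2), θ.Admissible F 2 →
      ∃ a : ℕ → ℝ, Summable a ∧ ∀ k (w : Fin (k + 2) → ℝ), w ∈ Box θ.γ (k + 1) →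
        |(datumOfRecord₁₃SepCoPH F 2 θ hP).βfun (k + 1) w - (datumOfRecord₁₃SepCoPH F 2 θ hP).βfun k (Fin.tail w)| ≤ a k)
    (hA : ∀ (F : T4Family) (θ : Stage13HParams F 2) (hP : θ.Provisos₁₃SepCoPH F 2), θ.Admissible F 2 →
      letI := θ.instVβ₁; letI := θ.instVβ₂; letI := θ.instιβ
      ∀ (k : ℕ) (δ : ℝ), 0 < δ → ∃ γ' : ℝ, 0 < γ' ∧ ∀ v ∈ Box γ' k,
        |(oneLoopSplit_betaOfMerged (betaMerged F (mergedTermFamilyMatT F 2 (TcanOfRecord F 2) (chiFixed29 F 2 θ.ν θ.ε₂₉) θ.εbg) θ.ρ8 θ.bV)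
            (beta0OfMerged (betaMerged F (mergedTermFamilyMatT F 2 (TcanOfRecord F 2) (chiFixed29 F 2 θ.ν θ.ε₂₉) θ.εbg) θ.ρ8 θ.bV) θ.v₀) θ.γ).β1 k v| ≤ δ)
    (F : T4Family) (θ : Stage13HParams F 2) (hP : θ.Provisos₁₃SepCoPH F 2) (hθ : θ.Admissible F 2) :
    letI := θ.instVβ₁; letI := θ.instVβ₂; letI := θ.instιβ
    EverySlope
      (oneLoopSplit_betaOfMerged (betaMerged F (mergedTermFamilyMatT F 2 (TcanOfRecord F 2) (chiFixed29 F 2 θ.ν θ.ε₂₉) θ.εbg) θ.ρ8 θ.bV)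
        (beta0OfMerged (betaMerged F (mergedTermFamilyMatT F 2 (TcanOfRecord F 2) (chiFixed29 F 2 θ.ν θ.ε₂₉) θ.εbg) θ.ρ8 θ.bV) θ.v₀) θ.γ)
      θ.γ := by
  letI := θ.instVβ₁; letI := θ.instVβ₂; letI := θ.instιβ
  obtain ⟨a, ha, hmod⟩ := hS F θ hP hθ
  exact everySlope_of_summable_shiftModulus_anchor _ hθ.toStage12.toStage9.gamma_pos (hA F θ hP hθ) hmod ha

/-- … and `N17AtRecord13`'s body IMPLIES the summable-shift hypothesis (geometric ⟹ summable, `a_k := (u.cr·u.C₅·u.θ)·u.ρ^k`), so the hedge is a WEAKENING of line 2's N17 slot,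
never a strengthening. [folklore] -/
theorem summableShift13_of_n17
    (hN : ∀ (F : T4Family) (θ : Stage13HParams F 2) (hP : θ.Provisos₁₃SepCoPH F 2), θ.Admissible F 2 →
      ∃ u : YMDAG.UVSplit.U3Carriers, u.γ = θ.γ ∧ 0 ≤ u.ρ ∧ u.ρ < 1 ∧ YMDAG.UVSplit.N17At (datumOfRecord₁₃SepCoPH F 2 θ hP) u)
    (F : T4Family) (θ : Stage13HParams F 2) (hP : θ.Provisos₁₃SepCoPH F 2) (hθ : θ.Admissible F 2) :
    ∃ a : ℕ → ℝ, Summable a ∧ ∀ k (w : Fin (k + 2) → ℝ), w ∈ Box θ.γ (k + 1) →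
      |(datumOfRecord₁₃SepCoPH F 2 θ hP).βfun (k + 1) w - (datumOfRecord₁₃SepCoPH F 2 θ hP).βfun k (Fin.tail w)| ≤ a k := by
  obtain ⟨u, hγu, hρ0, hρ1, h17⟩ := hN F θ hP hθ
  have h' : ScaleShiftRate (u.cr * u.C₅ * u.θ) u.ρ u.γ (datumOfRecord₁₃SepCoPH F 2 θ hP).βfun := h17
  rw [hγu] at h'
  exact ⟨fun k => u.cr * u.C₅ * u.θ * u.ρ ^ k, (summable_geometric_of_lt_one hρ0 hρ1).mul_left _, h'⟩

end K2TextsSummable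

end Summit.QuantumFields.YangMills.BalabanUVNodes.N17ShiftModulusAnchorRecord13

end
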